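import Summits.ResolutionOfSingularities.ResolutionOfSingularities.Theorems.FrobeniusClosingSteerBetaPolygonWords
import Mathlib.Algebra.Order.Floor.Semifield
import Mathlib.RingTheory.Filtration
import HarnessLib

/-!
# Crux `Steer` (stmt-ResolutionOfSingularities-16345), chain W4.1 — hK4′ β-leaf, K-β1♭ `PrepDebtHat` brick A (gauge-free half):
# ROUNDING TO `(1/d!)ℕ`, ATTAINED MAXIMA OF BOUNDED THRESHOLD FAMILIES, AND FINITENESS OF `β` ON A `d!`-INTEGRAL COLUMN (Krull)

OURS (campaign `res-hironaka`, rung L ★L-G4, slot W4.1; seat res-L0-w41-stub-1 g4 = K-β1♭ owner, res-L0-w41-plan-1 RULINGS 140/143/147b;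
blueprint `L/res-L0-w41-stub-1/KBETA1-BLUEPRINT.md` 4807652a0eeb53d4 §1 steps (1)–(2), §3 row A). Statements about res-L0-w41-idea-1's polygon
words (tree: `…BetaPolygonWords` p536143 — `AlphaGe`, `BetaGe`); the GAUGE words (plain or twisted, res-L0-w41-plan-1 RULING 150) are NOT used
here: the sup/attainment statement is proved for an ABSTRACT downward-closed, roundable, bounded family `P : ℚ → Prop` (`exists_max_of_round`), to
be instantiated with `AlphaStarGe`/`IsVStar` in the gauge half. They replace the role of no printed item and are NOT statements of the manuscript
under review [claim: Hironaka2017, status: under-review]; AI review weaker than expert review. Theses-free, definition-free.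

## Content

* §1 the threshold predicates depend on `ρ` only through `⌈ρ·n⌉₊`, `n = d − i − j ∈ [1, d]`: `alphaGe_of_ceil_le`, `betaGe_of_ceil_le`,
  `betaGe_anti`, `alphaGe_zero`; ROUNDING `exists_round` (`ρ̄ := min_{n ≤ d} ⌈ρ n⌉₊/n ≥ ρ`, `d!·ρ̄ ∈ ℕ`, exponents not increased),
  `alphaGe_round`, `betaGe_round`.
* §2 **`exists_max_of_round`**: a family `P : ℚ → Prop` with `P 0`, downward closed, closed under rounding to `(1/d!)ℕ` and failing at some
  `ρ₀` has an ATTAINED maximum `α` with `d!·α ∈ ℕ` (`Nat.findGreatest`); instance **`exists_max_betaGe`** (a bounded `β`-family on a column).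
* §3 **`alphaGe_of_forall_betaGe`** (Noetherian local `S`, `y ∈ 𝔪`, `α = k/d!`): `(∀ ρ, BetaGe … α ρ f) → AlphaGe … (α + 1/(d·d!)) f` — so a
  representative whose `α` is MAXIMAL has finite `β` (step (2) of `PrepDebtHat`); ingredients: Krull (`mem_of_forall_mem_sup_maximalIdeal_pow`, the argument of ✓ `CossartPiltant.mem_of_forall_mem_sup_pow`)
  and `ceil_add_inv_mul_le`: `⌈(k/d! + 1/(d·d!))·n⌉₊ ≤ (k n)/d! + 1` for `n ≤ d`.

[cite: CossartJannsenSaito2020, (11.4)] [cite: Matsumura1987, Thm. 8.10] [folklore]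
-/

-- `Summit.<S>.<S>.…` duplicates the summit name by design (single-problem summit).
set_option linter.dupNamespace false
set_option autoImplicit false

open IsLocalRing

namespace Summit.ResolutionOfSingularities.ResolutionOfSingularities.Theorems.SwitchingDichotomy.BetaPolygon

variable {S : Type} [CommRing S]

/-! ## §1 Dependence on `ρ` through `⌈ρ·n⌉₊` only; rounding to `(1/d!)ℕ` -/

/-- `AlphaGe` is monotone in the exponent function `(i,j) ↦ ⌈ρ(d−i−j)⌉₊` (smaller exponents = bigger ideal). [folklore] -/
theorem alphaGe_of_ceil_le {x z w : S} {d : ℕ} {ρ ρ' : ℚ}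
    (h : ∀ i j : ℕ, i + j < d → ⌈ρ' * ((d - i - j : ℕ) : ℚ)⌉₊ ≤ ⌈ρ * ((d - i - j : ℕ) : ℚ)⌉₊) {f : S}
    (hf : AlphaGe x z w d ρ f) : AlphaGe x z w d ρ' f := by
  unfold AlphaGe at hf ⊢
  refine SetLike.le_def.mp (sup_le_sup_left (iSup_mono fun i => iSup_mono fun j => iSup_mono fun hij => ?_) _) hf
  exact Ideal.span_singleton_le_span_singleton.mpr
    (mul_dvd_mul (mul_dvd_mul (pow_dvd_pow x (h i j hij)) (dvd_refl _)) (dvd_refl _))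

/-- `BetaGe` is monotone in the exponent function `(i,j) ↦ ⌈ρ(d−i−j)⌉₊` of `y`. [folklore] -/
theorem betaGe_of_ceil_le {x y z w : S} {d : ℕ} {α ρ ρ' : ℚ}
    (h : ∀ i j : ℕ, i + j < d → ⌈ρ' * ((d - i - j : ℕ) : ℚ)⌉₊ ≤ ⌈ρ * ((d - i - j : ℕ) : ℚ)⌉₊) {f : S}
    (hf : BetaGe x y z w d α ρ f) : BetaGe x y z w d α ρ' f := by
  unfold BetaGe at hf ⊢
  refine SetLike.le_def.mp (sup_le_sup_left (iSup_mono fun i => iSup_mono fun j => iSup_mono fun hij =>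
    sup_le_sup_left ?_ _) _) hf
  exact Ideal.span_singleton_le_span_singleton.mpr
    (mul_dvd_mul (mul_dvd_mul (mul_dvd_mul (dvd_refl _) (pow_dvd_pow y (h i j hij))) (dvd_refl _)) (dvd_refl _))

/-- `BetaGe` is antitone in `ρ`. [folklore] -/
theorem betaGe_anti {x y z w : S} {d : ℕ} {α ρ ρ' : ℚ} (h : ρ ≤ ρ') {f : S} (hf : BetaGe x y z w d α ρ' f) :
    BetaGe x y z w d α ρ f :=
  betaGe_of_ceil_le (fun i j _ => Nat.ceil_mono (mul_le_mul_of_nonneg_right h (by positivity))) hf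

/-- `α ≥ 0` always: the threshold ideal at `ρ = 0` is the whole ring. [folklore] -/
theorem alphaGe_zero (x z w : S) (d : ℕ) (f : S) : AlphaGe x z w d 0 f := by
  unfold AlphaGe
  rcases Nat.eq_zero_or_pos d with hd | hd
  · subst hd
    rw [pow_zero, Ideal.one_eq_top]
    exact Submodule.mem_sup_left Submodule.mem_top
  · refine Submodule.mem_sup_right ?_
    refine Ideal.mem_iSup_of_mem 0 (Ideal.mem_iSup_of_mem 0 (Ideal.mem_iSup_of_mem (by omega) ?_))
    simp

/-- **Rounding.** The exponents `⌈ρ·n⌉₊`, `1 ≤ n ≤ d`, are not increased by replacing `ρ` with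
`ρ̄ := min_{1 ≤ n ≤ d} ⌈ρ·n⌉₊ / n ≥ ρ`, and `d!·ρ̄ ∈ ℕ` (no sign hypothesis: `⌈·⌉₊` clamps at `0`). [cite: CossartJannsenSaito2020, (11.4)] -/
theorem exists_round {d : ℕ} (hd : 1 ≤ d) (ρ : ℚ) :
    ∃ ρ' : ℚ, ρ ≤ ρ' ∧ (∃ m : ℕ, (d.factorial : ℚ) * ρ' = m) ∧
      ∀ n : ℕ, 1 ≤ n → n ≤ d → ⌈ρ' * (n : ℚ)⌉₊ ≤ ⌈ρ * (n : ℚ)⌉₊ := by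
  classical
  -- minimise `⌈ρ n⌉₊ / n` over `n ∈ [1, d]`
  let F : Finset ℕ := Finset.Icc 1 d
  have hF : F.Nonempty := ⟨1, Finset.mem_Icc.mpr ⟨le_rfl, hd⟩⟩
  obtain ⟨n₀, hn₀F, hmin⟩ := F.exists_min_image (fun n : ℕ => (⌈ρ * (n : ℚ)⌉₊ : ℚ) / n) hF
  obtain ⟨hn₀1, hn₀d⟩ := Finset.mem_Icc.mp hn₀F
  have hn₀pos : (0 : ℚ) < n₀ := by exact_mod_cast hn₀1
  refine ⟨(⌈ρ * (n₀ : ℚ)⌉₊ : ℚ) / n₀, ?_, ?_, ?_⟩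
  · rw [le_div_iff₀ hn₀pos]
    exact Nat.le_ceil _
  · -- `d! · ⌈ρ n₀⌉₊ / n₀ = (d!/n₀) · ⌈ρ n₀⌉₊`
    obtain ⟨c, hc⟩ := Nat.dvd_factorial hn₀1 hn₀d
    refine ⟨c * ⌈ρ * (n₀ : ℚ)⌉₊, ?_⟩
    rw [hc]; push_cast
    field_simp
  · intro n hn1 hnd
    have hnpos : (0 : ℚ) < n := by exact_mod_cast hn1
    have hle : (⌈ρ * (n₀ : ℚ)⌉₊ : ℚ) / n₀ ≤ (⌈ρ * (n : ℚ)⌉₊ : ℚ) / n := hmin n (Finset.mem_Icc.mpr ⟨hn1, hnd⟩)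
    refine Nat.ceil_le.mpr ?_
    calc (⌈ρ * (n₀ : ℚ)⌉₊ : ℚ) / n₀ * n ≤ (⌈ρ * (n : ℚ)⌉₊ : ℚ) / n * n := by gcongr
      _ = ⌈ρ * (n : ℚ)⌉₊ := div_mul_cancel₀ _ hnpos.ne'

/-- Rounding for `AlphaGe`: `AlphaGe ρ f ⇒ AlphaGe ρ̄ f` for some `d!`-integral `ρ̄ ≥ ρ`. [cite: CossartJannsenSaito2020, (11.4)] -/
theorem alphaGe_round {x z w : S} {d : ℕ} (hd : 1 ≤ d) {ρ : ℚ} {f : S} (hf : AlphaGe x z w d ρ f) :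
    ∃ ρ' : ℚ, ρ ≤ ρ' ∧ (∃ m : ℕ, (d.factorial : ℚ) * ρ' = m) ∧ AlphaGe x z w d ρ' f := by
  obtain ⟨ρ', hρρ', hm, hceil⟩ := exists_round hd ρ
  exact ⟨ρ', hρρ', hm, alphaGe_of_ceil_le (fun i j hij => hceil _ (by omega) (by omega)) hf⟩

/-- Rounding for `BetaGe`. [cite: CossartJannsenSaito2020, (11.4)] -/
theorem betaGe_round {x y z w : S} {d : ℕ} (hd : 1 ≤ d) {α ρ : ℚ} {f : S}
    (hf : BetaGe x y z w d α ρ f) :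
    ∃ ρ' : ℚ, ρ ≤ ρ' ∧ (∃ m : ℕ, (d.factorial : ℚ) * ρ' = m) ∧ BetaGe x y z w d α ρ' f := by
  obtain ⟨ρ', hρρ', hm, hceil⟩ := exists_round hd ρ
  exact ⟨ρ', hρρ', hm, betaGe_of_ceil_le (fun i j hij => hceil _ (by omega) (by omega)) hf⟩

/-! ## §2 Attained maxima of bounded, roundable threshold families -/

/-- **Attained `d!`-integral maximum.** A family `P : ℚ → Prop` holding at `0`, downward closed, closed under rounding up to `(1/d!)ℕ`, and
failing at some `ρ₀`, has a maximum `α`, attained, with `d!·α ∈ ℕ`. [cite: CossartJannsenSaito2020, (11.4)] -/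
theorem exists_max_of_round {d : ℕ} (P : ℚ → Prop) (h0 : P 0) (hanti : ∀ ρ ρ' : ℚ, ρ ≤ ρ' → P ρ' → P ρ)
    (hround : ∀ ρ : ℚ, P ρ → ∃ ρ' : ℚ, ρ ≤ ρ' ∧ (∃ m : ℕ, (d.factorial : ℚ) * ρ' = m) ∧ P ρ') {ρ₀ : ℚ} (hfin : ¬ P ρ₀) :
    ∃ α : ℚ, P α ∧ (∀ ρ : ℚ, P ρ → ρ ≤ α) ∧ ∃ m : ℕ, (d.factorial : ℚ) * α = m := by
  classical
  let Q : ℕ → Prop := fun m => P ((m : ℚ) / d.factorial)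
  have hD : (0 : ℚ) < d.factorial := by exact_mod_cast d.factorial_pos
  have hQ0 : Q 0 := by
    change P ((0 : ℕ) / (d.factorial : ℚ))
    rw [Nat.cast_zero, zero_div]
    exact h0
  have hbdd : ∀ m, Q m → m ≤ ⌈ρ₀ * (d.factorial : ℚ)⌉₊ := by
    intro m hm
    have hlt : (m : ℚ) / d.factorial < ρ₀ := by
      by_contra hle; exact hfin (hanti _ _ (not_lt.mp hle) hm)
    rw [div_lt_iff₀ hD] at hlt
    exact_mod_cast (le_of_lt (lt_of_lt_of_le hlt (Nat.le_ceil _)) : (m : ℚ) ≤ ⌈ρ₀ * (d.factorial : ℚ)⌉₊)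
  let M : ℕ := Nat.findGreatest Q ⌈ρ₀ * (d.factorial : ℚ)⌉₊
  have hQM : Q M := Nat.findGreatest_spec (P := Q) (Nat.zero_le _) hQ0
  refine ⟨(M : ℚ) / d.factorial, hQM, fun ρ hρ => ?_, ⟨M, by field_simp⟩⟩
  obtain ⟨ρ', hρρ', ⟨m, hm⟩, hP'⟩ := hround ρ hρ
  have hρ'eq : ρ' = (m : ℚ) / d.factorial := by
    rw [eq_div_iff hD.ne', mul_comm]; exact hm
  have hQm : Q m := by
    change P ((m : ℚ) / d.factorial)
    rw [← hρ'eq]; exact hP'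
  have hmM : m ≤ M := Nat.le_findGreatest (hbdd m hQm) hQm
  calc ρ ≤ ρ' := hρρ'
    _ = (m : ℚ) / d.factorial := hρ'eq
    _ ≤ (M : ℚ) / d.factorial := by gcongr

/-- **Attained `β` on a column** (instance of `exists_max_of_round`): if `BetaGe … α 0 f` and `BetaGe … α ρ₀ f` fails, the `β`-value of `f` on
the column `α` is an attained maximum in `(1/d!)ℕ`. [cite: CossartJannsenSaito2020, (11.4)] -/
theorem exists_max_betaGe (x y z w : S) {d : ℕ} (hd : 1 ≤ d) {α : ℚ} (f : S) (h0 : BetaGe x y z w d α 0 f) {ρ₀ : ℚ}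
    (hfin : ¬ BetaGe x y z w d α ρ₀ f) :
    ∃ β : ℚ, BetaGe x y z w d α β f ∧ (∀ ρ : ℚ, BetaGe x y z w d α ρ f → ρ ≤ β) ∧ ∃ m : ℕ, (d.factorial : ℚ) * β = m :=
  exists_max_of_round (fun ρ => BetaGe x y z w d α ρ f) h0 (fun _ _ h hf => betaGe_anti h hf)
    (fun _ hρ => betaGe_round hd hρ) hfin

/-! ## §3 A representative with maximal `α` has finite `β` (step (2) of `PrepDebtHat`) -/

/-- Ideals of a Noetherian local ring are adically closed: `(∀ n, f ∈ 𝔞 + 𝔪ⁿ) ⇒ f ∈ 𝔞` (Krull's intersection theorem in `S ⧸ 𝔞`;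
same argument as ✓ `CossartPiltant.mem_of_forall_mem_sup_pow`, restated to keep this file's imports minimal). [cite: Matsumura1987, Thm. 8.10] -/
theorem mem_of_forall_mem_sup_maximalIdeal_pow [IsNoetherianRing S] [IsLocalRing S] {𝔞 : Ideal S} {f : S}
    (hf : ∀ n : ℕ, f ∈ 𝔞 ⊔ maximalIdeal S ^ n) : f ∈ 𝔞 := by
  have hbar : ∀ k, (Submodule.Quotient.mk f : S ⧸ 𝔞) ∈ (maximalIdeal S ^ k • ⊤ : Submodule S (S ⧸ 𝔞)) := by
    intro k
    obtain ⟨y, hy, z, hz, hyz⟩ := Submodule.mem_sup.mp (hf k)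
    have : (Submodule.Quotient.mk f : S ⧸ 𝔞) = z • Submodule.Quotient.mk (1 : S) := by
      rw [← hyz, Submodule.Quotient.mk_add, (Submodule.Quotient.mk_eq_zero _).mpr hy, zero_add,
        ← Submodule.Quotient.mk_smul, smul_eq_mul, mul_one]
    rw [this]
    exact Submodule.smul_mem_smul hz Submodule.mem_top
  have hKrull : (⨅ k : ℕ, maximalIdeal S ^ k • ⊤ : Submodule S (S ⧸ 𝔞)) = ⊥ :=
    Ideal.iInf_pow_smul_eq_bot_of_isLocalRing (I := maximalIdeal S) (M := S ⧸ 𝔞)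
      (IsLocalRing.maximalIdeal.isMaximal S).ne_top
  have hzero : (Submodule.Quotient.mk f : S ⧸ 𝔞) = 0 := by
    rw [← Submodule.mem_bot S, ← hKrull, Submodule.mem_iInf]
    exact hbar
  exact (Submodule.Quotient.mk_eq_zero _).mp hzero

/-- The rounding inequality behind step (2): for `α = k/d!`, `n ≤ d`: `⌈(α + 1/(d·d!))·n⌉₊ ≤ ⌊α·n⌋₊ + 1`. [folklore] -/
theorem ceil_add_inv_mul_le {d : ℕ} (hd : 1 ≤ d) (k n : ℕ) (hnd : n ≤ d) :
    ⌈((k : ℚ) / d.factorial + 1 / ((d : ℚ) * d.factorial)) * (n : ℚ)⌉₊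
      ≤ ⌊(k : ℚ) / d.factorial * (n : ℚ)⌋₊ + 1 := by
  have hD : (0 : ℚ) < d.factorial := by exact_mod_cast d.factorial_pos
  have hdq : (1 : ℚ) ≤ d := by exact_mod_cast hd
  -- `⌊k n / d!⌋₊ = (k n) / d!` (natural division)
  have hfloor : ⌊(k : ℚ) / d.factorial * (n : ℚ)⌋₊ = k * n / d.factorial := by
    rw [div_mul_eq_mul_div, show (k : ℚ) * n = ((k * n : ℕ) : ℚ) by push_cast; ring]
    exact Nat.floor_div_eq_div (k * n) d.factorial
  rw [hfloor]
  refine Nat.ceil_le.mpr ?_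
  -- `k n = d! · (k n / d!) + r`, `r ≤ d! − 1`
  have hdiv : ((k * n : ℕ) : ℚ) = (d.factorial : ℚ) * ((k * n / d.factorial : ℕ) : ℚ) + ((k * n % d.factorial : ℕ) : ℚ) := by
    exact_mod_cast (Nat.div_add_mod (k * n) d.factorial).symm
  have hmod : ((k * n % d.factorial : ℕ) : ℚ) ≤ (d.factorial : ℚ) - 1 := by
    have h := Nat.mod_lt (k * n) d.factorial_pos
    have : k * n % d.factorial ≤ d.factorial - 1 := by omega
    have hcast : ((k * n % d.factorial : ℕ) : ℚ) ≤ ((d.factorial - 1 : ℕ) : ℚ) := by exact_mod_cast this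
    rwa [Nat.cast_sub d.factorial_pos, Nat.cast_one] at hcast
  have hnq : (n : ℚ) ≤ d := by exact_mod_cast hnd
  -- the two summands
  have h1 : (k : ℚ) / d.factorial * n ≤ ((k * n / d.factorial : ℕ) : ℚ) + ((d.factorial : ℚ) - 1) / d.factorial := by
    rw [div_mul_eq_mul_div, show (k : ℚ) * n = ((k * n : ℕ) : ℚ) by push_cast; ring, hdiv, add_div,
      mul_div_cancel_left₀ _ hD.ne']
    gcongr
  have h2 : 1 / ((d : ℚ) * d.factorial) * n ≤ 1 / d.factorial := by
    rw [div_mul_eq_mul_div, one_mul, div_le_div_iff₀ (by positivity) hD]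
    nlinarith
  calc ((k : ℚ) / d.factorial + 1 / ((d : ℚ) * d.factorial)) * (n : ℚ)
      = (k : ℚ) / d.factorial * n + 1 / ((d : ℚ) * d.factorial) * n := by ring
    _ ≤ (((k * n / d.factorial : ℕ) : ℚ) + ((d.factorial : ℚ) - 1) / d.factorial) + 1 / d.factorial := add_le_add h1 h2
    _ = ((k * n / d.factorial : ℕ) : ℚ) + 1 := by field_simp; ring
    _ = ((k * n / d.factorial + 1 : ℕ) : ℚ) := by push_cast; ring

/-- **Finiteness of `β` on the column (Krull).** In a Noetherian local ring with `y ∈ 𝔪`: if `BetaGe … α ρ f` holds for EVERY `ρ`, with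
`α = k/d!`, then `AlphaGe … (α + 1/(d·d!)) f`. (The `β`-ideals at level `ρ` lie in `I_right + 𝔪^⌈ρ⌉`, `I_right` = «strictly right of the
column»; ideals are adically closed; and `I_right` lies in the `α`-ideal one rounding step to the right.) [cite: Matsumura1987, Thm. 8.10] -/
theorem alphaGe_of_forall_betaGe [IsNoetherianRing S] [IsLocalRing S] {x y z w : S} (hy : y ∈ maximalIdeal S) {d : ℕ}
    (hd : 1 ≤ d) (k : ℕ) {f : S} (h : ∀ ρ : ℚ, BetaGe x y z w d ((k : ℚ) / d.factorial) ρ f) :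
    AlphaGe x z w d ((k : ℚ) / d.factorial + 1 / ((d : ℚ) * d.factorial)) f := by
  -- the «strictly right of the column» ideal `Ir`
  obtain ⟨Ir, hIr⟩ : ∃ Ir : Ideal S, Ir = Ideal.span {z, w} ^ d ⊔
      ⨆ (i : ℕ) (j : ℕ) (_ : i + j < d),
        Ideal.span {x ^ (⌊(k : ℚ) / d.factorial * ((d - i - j : ℕ) : ℚ)⌋₊ + 1) * z ^ i * w ^ j} := ⟨_, rfl⟩
  -- (a) `f ∈ Ir + 𝔪^N` for every `N`
  have hmem : ∀ N : ℕ, f ∈ Ir ⊔ maximalIdeal S ^ N := by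
    intro N
    have hN := h (N : ℚ)
    unfold BetaGe at hN
    refine (?_ : _ ≤ Ir ⊔ maximalIdeal S ^ N) hN
    refine sup_le (le_sup_of_le_left (by rw [hIr]; exact le_sup_left)) ?_
    refine iSup_le fun i => iSup_le fun j => iSup_le fun hij => sup_le ?_ ?_
    · refine le_sup_of_le_left ?_
      rw [hIr]
      refine le_sup_of_le_right (le_iSup_of_le i (le_iSup_of_le j (le_iSup_of_le hij le_rfl)))
    · refine le_sup_of_le_right ?_
      rw [Ideal.span_singleton_le_iff_mem]
      have hle : N ≤ ⌈(N : ℚ) * ((d - i - j : ℕ) : ℚ)⌉₊ := by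
        have h1 : (1 : ℚ) ≤ ((d - i - j : ℕ) : ℚ) := by exact_mod_cast (show 1 ≤ d - i - j by omega)
        have h2 : (N : ℚ) ≤ (N : ℚ) * ((d - i - j : ℕ) : ℚ) := le_mul_of_one_le_right (by positivity) h1
        have h3 : (N : ℚ) ≤ (⌈(N : ℚ) * ((d - i - j : ℕ) : ℚ)⌉₊ : ℚ) := h2.trans (Nat.le_ceil _)
        exact_mod_cast h3
      have hyN : y ^ ⌈(N : ℚ) * ((d - i - j : ℕ) : ℚ)⌉₊ ∈ maximalIdeal S ^ N :=
        Ideal.pow_le_pow_right hle (Ideal.pow_mem_pow hy _)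
      have h4 := Ideal.mul_mem_left (maximalIdeal S ^ N)
        (x ^ ⌈(k : ℚ) / d.factorial * ((d - i - j : ℕ) : ℚ)⌉₊) hyN
      have h5 := Ideal.mul_mem_right (z ^ i * w ^ j) (maximalIdeal S ^ N) h4
      simpa only [mul_assoc] using h5
  -- (b) Krull: `f ∈ Ir`
  have hf : f ∈ Ir := mem_of_forall_mem_sup_maximalIdeal_pow hmem
  -- (c) `Ir` lies in the `α'`-ideal
  rw [hIr] at hf
  unfold AlphaGe
  refine SetLike.le_def.mp (sup_le_sup_left (iSup_mono fun i => iSup_mono fun j => iSup_mono fun hij => ?_) _) hf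
  refine Ideal.span_singleton_le_span_singleton.mpr (mul_dvd_mul (mul_dvd_mul (pow_dvd_pow x ?_) (dvd_refl _)) (dvd_refl _))
  exact ceil_add_inv_mul_le hd k (d - i - j) (by omega)

end Summit.ResolutionOfSingularities.ResolutionOfSingularities.Theorems.SwitchingDichotomy.BetaPolygon
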